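import Summits.AtomisticToContinuum.HydrodynamicLimit.Theorems.CollisionIsometryCLTCollisionalTransferLocalityCcTimeIntegralConst
import Summits.AtomisticToContinuum.HydrodynamicLimit.Theorems.CollisionIsometryCLTCollisionalTransferLocalityCcTendstoZeroConst
import Summits.AtomisticToContinuum.HydrodynamicLimit.Theorems.CollisionIsometryCLTCollisionalTransferLocalityGibbsTranslation
import HarnessLib

/-!
# The equilibrium rung of the crux `CollisionalTransferLocality`, collisional side
(line `hemisphere-affine-slaving`, stmt-AtomisticToContinuum-9518; lead seat c5)

At GLOBAL EQUILIBRIUM — the flow-invariant homogeneous local Gibbs law `G_N` of activity `1`,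
velocity `0` and temperature `θ` — the crux's collisional residual
`Cc(τ) = [⟨μ, ψ·v + χ|v|²/2⟩]₀^τ − ∫₀^τ (⟨μ, ∂ₛψ·v + ∂ₛχ|v|²/2⟩ + d/dr|₀⟨μ∘S_r, ψ·v + χ|v|²/2⟩) ds`
(by [S1] the normalised sum of the collision jumps of the tested momentum + energy over `(0, τ]`)
tends to `0` in `G_N`-probability at every FIXED `τ ≤ t`, for every reduced density `σ` below the
cluster radius of the static law of large numbers and every hard-sphere flow family. This is the first
rung of the research stub [M] (`stub_markedVirialE`) and of the crux itself on the collision side: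
the right-hand side `∫∫(div ψ + ∇χ·ū) p_c(ρ̄, θ̄)` vanishes at equilibrium too (`∫ div ψ = 0`; Rhs side,
next file), so the crux's identity holds at equilibrium at each fixed time. No ergodic or mixing input:
stationarity of `G_N` under every `Φ_s` (`map_flow_localGibbsLaw_const`), the static laws of large
numbers for the one-time empirical averages (density: cluster expansion, `localGibbsLaw_const_densityLLN`;
velocity marks: conditional Bienaymé–Chebyshev, `obs_lln_const`, `stream_lln_const`), the closed form of
the streaming derivative (`deriv_Obs_freeFlight_eq`), joint measurability of the flow (`measurable_flowMod`)
for Tonelli in time (`tendsto_measure_setIntegral_of_forall`), and the calculus identities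
`∫ₓχ_τ − ∫ₓχ_0 = ∫₀^τ∫ₓ∂ₛχ` (`integral_slice_sub_eq_setIntegral_timeDeriv`), `∫ₓ div ψ = 0`
(`integral_sum_gradPsi_diag_eq_zero`). This file only assembles the two landed halves
`cc_timeIntegral_tendsto_const` (time-integral part) and `cc_tendsto_zero_of_timeIntegral_const`
(one-time parts + algebra) with the radius `σ₀ := min σ_LLN (1/2)`.
-/

namespace Summit.AtomisticToContinuum.HydrodynamicLimit.Theorems.HemisphereAffineSlaving

open scoped BigOperators Topology Classical ENNReal InnerProductSpace
open Filter Set Function MeasureTheory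

noncomputable section

open Literature.MathematicalPhysics.KineticTheory (T3 V3)

/-- **Equilibrium rung of the crux, collisional side (registered helper `cc_tendsto_zero_const` of
stmt-AtomisticToContinuum-9518).** For every temperature `θ > 0` there is `σ₀ > 0` such that for
`0 < σ < σ₀`, every hard-sphere flow family `Φ`, every horizon `t > 0`, all space–time tests `(ψ, χ)`
smooth on `[0, t]`, every fixed `τ ∈ [0, t]` and `δ > 0`, the probability under the homogeneous local
Gibbs law (activity `1`, velocity `0`, temperature `θ`) that the crux's collisional residual `Cc(τ)`
exceeds `δ` in absolute value tends to `0` as `N → ∞`. [folklore] -/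
theorem cc_tendsto_zero_const : ∀ θ : ℝ, 0 < θ → ∃ σ₀ : ℝ, 0 < σ₀ ∧ ∀ σ : ℝ, 0 < σ → σ < σ₀ → ∀ (Φ : Flows σ) (t : ℝ), 0 < t → ∀ (ψ : ℝ → T3 → V3) (χ : ℝ → T3 → ℝ), Literature.Analysis.FunctionSpaces.Torus.IsSmoothSpaceTimeOn (Icc 0 t) ψ → Literature.Analysis.FunctionSpaces.Torus.IsSmoothSpaceTimeOn (Icc 0 t) χ → ∀ τ ∈ Icc 0 t, ∀ δ : ℝ, 0 < δ → Tendsto (fun N : ℕ => Literature.MathematicalPhysics.KineticTheory.localGibbsLaw σ (fun _ => 1) (fun _ => 0) (fun _ => θ) N (Φ N) {z | δ < |Cc σ Φ ψ χ N z τ|}) atTop (𝓝 0) := by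
  intro θ hθ
  obtain ⟨σ₁, hσ₁, H⟩ := localGibbsLaw_const_densityLLN θ hθ
  refine ⟨min σ₁ (1 / 2), lt_min hσ₁ (by norm_num), ?_⟩
  intro σ hσ hlt Φ t ht ψ χ hψ hχ τ hτ δ hδ
  have hσ₁' : σ < σ₁ := lt_of_lt_of_le hlt (min_le_left _ _)
  have hhalf : σ ≤ 1 / 2 := (lt_of_lt_of_le hlt (min_le_right _ _)).le
  obtain ⟨hP, hL⟩ := H σ hσ hσ₁' Φ
  exact cc_tendsto_zero_of_timeIntegral_const hθ Φ hP hL ht hψ hχ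
    (cc_timeIntegral_tendsto_const hθ hhalf Φ hP hL ht hψ hχ) τ hτ δ hδ

end

end Summit.AtomisticToContinuum.HydrodynamicLimit.Theorems.HemisphereAffineSlaving
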